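/-
Copyright (c) 2026 The H21 project. Released under Apache 2.0 license.
-/
import Mathlib.Analysis.Normed.Module.FiniteDimension
import Mathlib.Topology.Order.MonotoneConvergence
import Summits.RiemannHypothesis.RiemannHypothesis.Theorems.PfPersistenceIntruderWitness
import HarnessLib

/-!
# PF-persistence THEORY 3 (gen 9) — the off-line CAPACITANCE is LOEWNER-MONOTONE up the
# `N`-ladder: Dirichlet principle, exact increment, residual enclosure, `PD ⇒ coercive`
# (publication cell `pub-rhpf`, theory seat 3)

Framing (page 1 of every `pub-rhpf` file): **mechanism/rigidity campaign — nothing here is a claim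
about RH.** Everything in this file is PROVED abstract linear algebra (no new definitions); no
statement about `ζ` or about any control family is made; every empirical sentence in the
docstrings is labelled DATA and refers to
`run/shared/lean/pub/pub-rhpf/pub-rhpf-theory-3/THEORY-INTRUDER.md` §14.

WHY THIS FILE.  The gen-5…8 laws reduce the negative index of a window `T = B − ∑ᵢ |vᵢ⟩⟨vᵢ|`
(`B ≥ 0` the remainder, `vᵢ` the off-line drivers) to the CAPACITANCE MATRIX `M = (⟪vᵢ, B⁻¹vⱼ⟫)`:
`n₋(T) = #{μ(M) > 1}` (`PfPersistenceIntruderWitness.secular_law`).  In the `a`-direction nothing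
structural relates two windows.  In the `N`-direction the cell's windows are NESTED
(`PfPersistenceIntruderIndexMono.datumOf_nested`: the `(a, N')` block is a principal compression of
the `(a, N)` block, and the driver profiles are truncations), and `IndexMono` proved the qualitative
consequence `n₋(a, N') ≤ n₋(a, N)`.  This file proves the QUANTITATIVE companion, abstractly, for a
nested pair (`J : E →ₗ E'`, `⟪B x, x⟫ = ⟪B'(Jx), Jx⟫`, `⟪vᵢ, x⟫ = ⟪v'ᵢ, Jx⟫`):

* §1 DIRICHLET PRINCIPLE: for `B ≥ 0` symmetric and a witness `B z = v`, the capacitance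
  `s = ⟪v, z⟫` is the MAXIMUM of `2⟪v, x⟫ − ⟪B x, x⟫` (attained at `x = z`, defect
  `⟪B(z − x), z − x⟫`); hence the certified two-sided RESIDUAL ENCLOSURE from ANY trial vector `x`
  and a coercivity constant `β`: `2⟪v,x⟫ − ⟪Bx,x⟫ ≤ s ≤ 2⟪v,x⟫ − ⟪Bx,x⟫ + ‖v − Bx‖²/β`, and the
  `B`-Cauchy–Schwarz bound `⟪v, x⟫² ≤ s·⟪B x, x⟫`.
* §2 NESTED PAIRS: the EXACT INCREMENT `s' − s = ⟪B'(z' − Jz), z' − Jz⟫ ≥ 0` (so `s ≤ s'`, with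
  equality iff `z' = J z` when `B'` is positive definite); the multi-driver version
  `cᵀ(M' − M)c = ⟪B' w_c, w_c⟫ ≥ 0`, `w_c = ∑ cⱼ z'ⱼ − J(∑ cⱼ zⱼ)` — `M ≤ M'` in the LOEWNER order,
  so EVERY eigenvalue `μₖ` of the capacitance matrix is non-decreasing up the ladder, and for every
  threshold `t` a `k`-dimensional subspace on which `t·I − M` is negative definite is one for `M'`.
* §3 SPLITS: for nested splits `S`, `S'` the window form itself is the compression
  (`⟪T x, x⟫ = ⟪T'(Jx), Jx⟫`), coercivity of the BIG remainder passes DOWN to the small one along an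
  isometric `J` (the DATA premise need only be certified at the top rung), and — hypothesis-free
  given that premise — the witnesses of both rungs exist and `cᵀM c ≤ cᵀM' c` for every `c`.
* §4 `PD ⇒ COERCIVE` in finite dimension (`∀ x ≠ 0, 0 < ⟪Bx,x⟫ ⇒ ∃ β > 0, β⟪x,x⟫ ≤ ⟪Bx,x⟫`,
  compactness of the unit sphere): the premise of every gen-8 theorem is exactly 'the remainder is
  positive definite', as certified per window.
* §5 THE LADDER LIMIT: a real sequence with `s N ≤ s (N+1)` either is bounded and converges to its
  supremum (which bounds every rung) or is unbounded and tends to `+∞`; an up-crossing of any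
  threshold is permanent.  With §2 this is the PROVED half of 'the continuum capacitance
  `s(a, ∞) ∈ (0, ∞]` exists as a monotone limit of the rungs'; WHICH alternative holds for a given
  control family and `a` is DATA (THEORY-INTRUDER §14: DH ladders, jobs `j073755`, `j073768`).

What is NOT proved: any rate of convergence in `N`, any statement in the `a`-direction, and the
premise itself (positive definiteness of the top-rung remainder is certified DATA per window).
Don't-look sentence (RULING A24 k4): every statement here holds for ANY nested pair of symmetric
windows admitting such splits — Davenport–Heilbronn, Epstein, planted controls alike; nothing in
this file separates `ζ` from a control.

## References
* R. A. Horn, C. R. Johnson, *Matrix Analysis*, 2nd ed. (2013), Thm 4.3.28 (inclusion principle),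
  §7.7 (Loewner order; `A ≤ B ⇒ λₖ(A) ≤ λₖ(B)`, Cor. 7.7.4). [HornJohnson2013]
* P. Arbenz, G. H. Golub, SIAM J. Matrix Anal. Appl. 9 (1988) 40–58. [ArbenzGolub1988]
* G. H. Golub, C. F. Van Loan, *Matrix Computations*, 4th ed. (2013), §11.3.2. [GolubVanLoan2013]
-/

open scoped InnerProductSpace BigOperators
open Filter Topology

set_option linter.dupNamespace false

namespace Summit.RiemannHypothesis.RiemannHypothesis.Theorems.PfPersistenceIntruderCapacitanceMono

open Summit.RiemannHypothesis.RiemannHypothesis.Theorems.PfPersistenceIntruderShadowMulti (OffLineSplitN)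
open Summit.RiemannHypothesis.RiemannHypothesis.Theorems.PfPersistenceIntruderWitness
  (mul_norm_le_norm_of_apply_eq exists_witnesses)

variable {E : Type*} [NormedAddCommGroup E] [InnerProductSpace ℝ E]
variable {E' : Type*} [NormedAddCommGroup E'] [InnerProductSpace ℝ E']

/-- Bookkeeping: a double coefficient sum of inner products is the inner product of the combinations,
`∑ᵢ∑ⱼ cᵢcⱼ⟪vᵢ, zⱼ⟫ = ⟪∑ cᵢvᵢ, ∑ cⱼzⱼ⟫`. [folklore] -/
theorem sum_sum_mul_inner_eq {ι : Type*} [Fintype ι] (v z : ι → E) (c : ι → ℝ) :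
    ∑ i, ∑ j, c i * c j * ⟪v i, z j⟫_ℝ = ⟪∑ i, c i • v i, ∑ j, c j • z j⟫_ℝ := by
  rw [sum_inner]
  refine Finset.sum_congr rfl fun i _ => ?_
  rw [real_inner_smul_left, inner_sum, Finset.mul_sum]
  refine Finset.sum_congr rfl fun j _ => ?_
  rw [real_inner_smul_right]; ring

/-! ## 1. Dirichlet principle: the capacitance is a maximum; residual enclosure -/

section Variational

variable (B : E →ₗ[ℝ] E)

/-- **Completion of the square**: for symmetric `B` and a witness `B z = v`, the defect of the trial
value `2⟪v,x⟫ − ⟪Bx,x⟫` below the capacitance `⟪v,z⟫` is the `B`-energy of the error,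
`⟪v,z⟫ − (2⟪v,x⟫ − ⟪Bx,x⟫) = ⟪B(z − x), z − x⟫`. [cite: GolubVanLoan2013, §11.3.2] -/
theorem secular_sub_trial_eq (hsymm : ∀ x y : E, ⟪B x, y⟫_ℝ = ⟪x, B y⟫_ℝ) {z v : E}
    (hz : B z = v) (x : E) :
    ⟪v, z⟫_ℝ - (2 * ⟪v, x⟫_ℝ - ⟪B x, x⟫_ℝ) = ⟪B (z - x), z - x⟫_ℝ := by
  have h1 : ⟪B x, z⟫_ℝ = ⟪v, x⟫_ℝ := by rw [hsymm, hz, real_inner_comm]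
  rw [map_sub, inner_sub_left, inner_sub_right, inner_sub_right, hz, h1]
  ring

/-- **Dirichlet principle (lower bounds)**: for `B ≥ 0` symmetric, EVERY trial vector bounds the
capacitance from below, `2⟪v,x⟫ − ⟪Bx,x⟫ ≤ ⟪v, z⟫` — a certified lower bound on `s` needs no
inversion, only one application of `B`. [cite: GolubVanLoan2013, §11.3.2] -/
theorem trial_le_secular (hsymm : ∀ x y : E, ⟪B x, y⟫_ℝ = ⟪x, B y⟫_ℝ)
    (hnonneg : ∀ x : E, 0 ≤ ⟪B x, x⟫_ℝ) {z v : E} (hz : B z = v) (x : E) :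
    2 * ⟪v, x⟫_ℝ - ⟪B x, x⟫_ℝ ≤ ⟪v, z⟫_ℝ := by
  have h := secular_sub_trial_eq B hsymm hz x
  have h2 := hnonneg (z - x)
  linarith

/-- The trial value at the witness itself is the capacitance: `2⟪v,z⟫ − ⟪Bz,z⟫ = ⟪v,z⟫`. [folklore] -/
theorem trial_self_eq {z v : E} (hz : B z = v) : 2 * ⟪v, z⟫_ℝ - ⟪B z, z⟫_ℝ = ⟪v, z⟫_ℝ := by
  rw [hz]; ring

/-- **The capacitance is the maximum of the Dirichlet functional** `x ↦ 2⟪v,x⟫ − ⟪Bx,x⟫`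
(`B ≥ 0` symmetric, `B z = v`). [cite: GolubVanLoan2013, §11.3.2] -/
theorem secular_isGreatest (hsymm : ∀ x y : E, ⟪B x, y⟫_ℝ = ⟪x, B y⟫_ℝ)
    (hnonneg : ∀ x : E, 0 ≤ ⟪B x, x⟫_ℝ) {z v : E} (hz : B z = v) :
    IsGreatest (Set.range fun x : E => 2 * ⟪v, x⟫_ℝ - ⟪B x, x⟫_ℝ) ⟪v, z⟫_ℝ :=
  ⟨⟨z, trial_self_eq B hz⟩, by
    rintro _ ⟨x, rfl⟩
    exact trial_le_secular B hsymm hnonneg hz x⟩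

/-- **Cauchy–Schwarz in the `B`-form**: `⟪v, x⟫² ≤ ⟪v, z⟫ · ⟪B x, x⟫` for every `x`
(`B ≥ 0` symmetric, `B z = v`) — the scale-optimised Dirichlet bound `s ≥ ⟪v,x⟫²/⟪Bx,x⟫`. [folklore] -/
theorem inner_sq_le_secular_mul (hsymm : ∀ x y : E, ⟪B x, y⟫_ℝ = ⟪x, B y⟫_ℝ)
    (hnonneg : ∀ x : E, 0 ≤ ⟪B x, x⟫_ℝ) {z v : E} (hz : B z = v) (x : E) :
    ⟪v, x⟫_ℝ ^ 2 ≤ ⟪v, z⟫_ℝ * ⟪B x, x⟫_ℝ := by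
  have hq : ∀ t : ℝ, 0 ≤ ⟪B x, x⟫_ℝ * (t * t) + (-(2 * ⟪v, x⟫_ℝ)) * t + ⟪v, z⟫_ℝ := by
    intro t
    have h := trial_le_secular B hsymm hnonneg hz (t • x)
    rw [map_smul, real_inner_smul_left, real_inner_smul_right, real_inner_smul_right] at h
    nlinarith [h]
  have hd := discrim_le_zero hq
  rw [discrim] at hd
  nlinarith [hd]

/-- **Residual enclosure (upper half)**: for a COERCIVE symmetric `B` (`β⟪y,y⟫ ≤ ⟪By,y⟫`, `β > 0`)
and a witness `B z = v`, every trial vector `x` gives the certified upper bound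
`⟪v, z⟫ ≤ 2⟪v,x⟫ − ⟪Bx,x⟫ + ‖v − B x‖² / β` (with `trial_le_secular`: a two-sided enclosure of the
capacitance of width `‖residual‖²/β` from an approximate solve). [folklore] -/
theorem secular_le_trial_add_residual {β : ℝ} (hβ : 0 < β)
    (hsymm : ∀ x y : E, ⟪B x, y⟫_ℝ = ⟪x, B y⟫_ℝ)
    (hco : ∀ y : E, β * ⟪y, y⟫_ℝ ≤ ⟪B y, y⟫_ℝ) {z v : E} (hz : B z = v) (x : E) :
    ⟪v, z⟫_ℝ ≤ 2 * ⟪v, x⟫_ℝ - ⟪B x, x⟫_ℝ + ‖v - B x‖ ^ 2 / β := by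
  have h := secular_sub_trial_eq B hsymm hz x
  have hres : B (z - x) = v - B x := by rw [map_sub, hz]
  have hn : β * ‖z - x‖ ≤ ‖v - B x‖ := mul_norm_le_norm_of_apply_eq B hco hres
  have hcs : ⟪B (z - x), z - x⟫_ℝ ≤ ‖v - B x‖ * ‖z - x‖ := by
    rw [hres]; exact real_inner_le_norm _ _
  have hzx : 0 ≤ ‖z - x‖ := norm_nonneg _
  have hr : 0 ≤ ‖v - B x‖ := norm_nonneg _
  have key : ⟪B (z - x), z - x⟫_ℝ ≤ ‖v - B x‖ ^ 2 / β := by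
    rw [le_div_iff₀ hβ]
    calc ⟪B (z - x), z - x⟫_ℝ * β ≤ ‖v - B x‖ * ‖z - x‖ * β := by
            exact mul_le_mul_of_nonneg_right hcs hβ.le
      _ = ‖v - B x‖ * (β * ‖z - x‖) := by ring
      _ ≤ ‖v - B x‖ * ‖v - B x‖ := mul_le_mul_of_nonneg_left hn hr
      _ = ‖v - B x‖ ^ 2 := by ring
  linarith

end Variational

/-! ## 2. Nested pairs: the exact increment and Loewner monotonicity of the capacitance -/

section Nested

variable (B : E →ₗ[ℝ] E) (B' : E' →ₗ[ℝ] E') (J : E →ₗ[ℝ] E')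

/-- **Exact increment of the capacitance along a nested pair.**  If the small remainder is the
compression of the big one (`⟪Bx,x⟫ = ⟪B'(Jx), Jx⟫`), the small driver is the pullback of the big one
(`⟪v,x⟫ = ⟪v', Jx⟫`), and `B z = v`, `B' z' = v'`, then
`⟪v', z'⟫ − ⟪v, z⟫ = ⟪B'(z' − Jz), z' − Jz⟫` — the Dirichlet defect of the transported small witness
as a trial vector for the big problem. [cite: HornJohnson2013, Thm 4.3.28] -/
theorem secular_increment_eq (hsymm' : ∀ x y : E', ⟪B' x, y⟫_ℝ = ⟪x, B' y⟫_ℝ)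
    (hcomp : ∀ x : E, ⟪B x, x⟫_ℝ = ⟪B' (J x), J x⟫_ℝ)
    {z v : E} {z' v' : E'} (hz : B z = v) (hz' : B' z' = v')
    (hpull : ∀ x : E, ⟪v, x⟫_ℝ = ⟪v', J x⟫_ℝ) :
    ⟪v', z'⟫_ℝ - ⟪v, z⟫_ℝ = ⟪B' (z' - J z), z' - J z⟫_ℝ := by
  have h := secular_sub_trial_eq B' hsymm' hz' (J z)
  rw [← hpull z, ← hcomp z, hz] at h
  linarith

/-- **The capacitance is non-decreasing up a nested pair**: `⟪v, z⟫ ≤ ⟪v', z'⟫` whenever the big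
remainder is `≥ 0`. [cite: HornJohnson2013, Thm 4.3.28] -/
theorem secular_mono (hsymm' : ∀ x y : E', ⟪B' x, y⟫_ℝ = ⟪x, B' y⟫_ℝ)
    (hnonneg' : ∀ y : E', 0 ≤ ⟪B' y, y⟫_ℝ)
    (hcomp : ∀ x : E, ⟪B x, x⟫_ℝ = ⟪B' (J x), J x⟫_ℝ)
    {z v : E} {z' v' : E'} (hz : B z = v) (hz' : B' z' = v')
    (hpull : ∀ x : E, ⟪v, x⟫_ℝ = ⟪v', J x⟫_ℝ) : ⟪v, z⟫_ℝ ≤ ⟪v', z'⟫_ℝ := by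
  have h := secular_increment_eq B B' J hsymm' hcomp hz hz' hpull
  have h2 := hnonneg' (z' - J z)
  linarith

/-- **Strictness**: for a positive DEFINITE big remainder the capacitance strictly increases iff the
big witness is not the transported small one, `⟪v,z⟫ < ⟪v',z'⟫ ↔ z' ≠ J z`. [folklore] -/
theorem secular_lt_iff (hsymm' : ∀ x y : E', ⟪B' x, y⟫_ℝ = ⟪x, B' y⟫_ℝ)
    (hpos' : ∀ y : E', y ≠ 0 → 0 < ⟪B' y, y⟫_ℝ)
    (hcomp : ∀ x : E, ⟪B x, x⟫_ℝ = ⟪B' (J x), J x⟫_ℝ)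
    {z v : E} {z' v' : E'} (hz : B z = v) (hz' : B' z' = v')
    (hpull : ∀ x : E, ⟪v, x⟫_ℝ = ⟪v', J x⟫_ℝ) : ⟪v, z⟫_ℝ < ⟪v', z'⟫_ℝ ↔ z' ≠ J z := by
  rw [← sub_pos, secular_increment_eq B B' J hsymm' hcomp hz hz' hpull]
  constructor
  · intro h heq
    rw [heq, sub_self, map_zero, inner_zero_left] at h
    exact lt_irrefl _ h
  · intro hne
    exact hpos' _ (sub_ne_zero.mpr hne)

variable {ι : Type*} [Fintype ι]

/-- **Exact increment of the capacitance FORM (multi-driver)**: with witness families `B zᵢ = vᵢ`,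
`B' z'ᵢ = v'ᵢ` and pulled-back drivers, for every coefficient vector
`cᵀM'c − cᵀMc = ⟪B' w, w⟫`, `w = ∑ cⱼz'ⱼ − J(∑ cⱼzⱼ)`. [cite: HornJohnson2013, Thm 4.3.28] -/
theorem capacitanceForm_increment_eq (hsymm' : ∀ x y : E', ⟪B' x, y⟫_ℝ = ⟪x, B' y⟫_ℝ)
    (hcomp : ∀ x : E, ⟪B x, x⟫_ℝ = ⟪B' (J x), J x⟫_ℝ)
    {z v : ι → E} {z' v' : ι → E'} (hz : ∀ i, B (z i) = v i) (hz' : ∀ i, B' (z' i) = v' i)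
    (hpull : ∀ i (x : E), ⟪v i, x⟫_ℝ = ⟪v' i, J x⟫_ℝ) (c : ι → ℝ) :
    ∑ i, ∑ j, c i * c j * ⟪v' i, z' j⟫_ℝ - ∑ i, ∑ j, c i * c j * ⟪v i, z j⟫_ℝ =
      ⟪B' (∑ j, c j • z' j - J (∑ j, c j • z j)), ∑ j, c j • z' j - J (∑ j, c j • z j)⟫_ℝ := by
  have hzc : B (∑ j, c j • z j) = ∑ i, c i • v i := by
    rw [map_sum]; exact Finset.sum_congr rfl fun i _ => by rw [map_smul, hz i]
  have hzc' : B' (∑ j, c j • z' j) = ∑ i, c i • v' i := by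
    rw [map_sum]; exact Finset.sum_congr rfl fun i _ => by rw [map_smul, hz' i]
  have hpullc : ∀ x : E, ⟪∑ i, c i • v i, x⟫_ℝ = ⟪∑ i, c i • v' i, J x⟫_ℝ := by
    intro x
    rw [sum_inner, sum_inner]
    exact Finset.sum_congr rfl fun i _ => by rw [real_inner_smul_left, real_inner_smul_left, hpull]
  rw [sum_sum_mul_inner_eq, sum_sum_mul_inner_eq]
  exact secular_increment_eq B B' J hsymm' hcomp hzc hzc' hpullc

/-- **Loewner monotonicity of the capacitance matrix**: `cᵀM c ≤ cᵀM' c` for every `c` (big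
remainder `≥ 0`), hence `μₖ(M) ≤ μₖ(M')` for every `k` — EVERY capacitance eigenvalue is
non-decreasing up the `N`-ladder. [cite: HornJohnson2013, Cor. 7.7.4] -/
theorem capacitanceForm_mono (hsymm' : ∀ x y : E', ⟪B' x, y⟫_ℝ = ⟪x, B' y⟫_ℝ)
    (hnonneg' : ∀ y : E', 0 ≤ ⟪B' y, y⟫_ℝ)
    (hcomp : ∀ x : E, ⟪B x, x⟫_ℝ = ⟪B' (J x), J x⟫_ℝ)
    {z v : ι → E} {z' v' : ι → E'} (hz : ∀ i, B (z i) = v i) (hz' : ∀ i, B' (z' i) = v' i)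
    (hpull : ∀ i (x : E), ⟪v i, x⟫_ℝ = ⟪v' i, J x⟫_ℝ) (c : ι → ℝ) :
    ∑ i, ∑ j, c i * c j * ⟪v i, z j⟫_ℝ ≤ ∑ i, ∑ j, c i * c j * ⟪v' i, z' j⟫_ℝ := by
  have h := capacitanceForm_increment_eq B B' J hsymm' hcomp hz hz' hpull c
  have h2 := hnonneg' (∑ j, c j • z' j - J (∑ j, c j • z j))
  linarith

/-- **Counting form, every threshold**: a `k`-dimensional coefficient subspace on which `t·I − M` is
negative definite is one on which `t·I − M'` is — `#{μ(M) > t} ≤ #{μ(M') > t}` for every `t`; at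
`t = 1` (with the secular law) this is the capacitance-side proof of `n₋(T) ≤ n₋(T')`.
[cite: HornJohnson2013, Cor. 7.7.4] -/
theorem negSubspace_threshold_mono (hsymm' : ∀ x y : E', ⟪B' x, y⟫_ℝ = ⟪x, B' y⟫_ℝ)
    (hnonneg' : ∀ y : E', 0 ≤ ⟪B' y, y⟫_ℝ)
    (hcomp : ∀ x : E, ⟪B x, x⟫_ℝ = ⟪B' (J x), J x⟫_ℝ)
    {z v : ι → E} {z' v' : ι → E'} (hz : ∀ i, B (z i) = v i) (hz' : ∀ i, B' (z' i) = v' i)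
    (hpull : ∀ i (x : E), ⟪v i, x⟫_ℝ = ⟪v' i, J x⟫_ℝ) (t : ℝ) {k : ℕ}
    (hk : ∃ U : Submodule ℝ (ι → ℝ), Module.finrank ℝ U = k ∧
      ∀ c ∈ U, c ≠ 0 → (t * ∑ i, c i ^ 2 - ∑ i, ∑ j, c i * c j * ⟪v i, z j⟫_ℝ) < 0) :
    ∃ U : Submodule ℝ (ι → ℝ), Module.finrank ℝ U = k ∧
      ∀ c ∈ U, c ≠ 0 → (t * ∑ i, c i ^ 2 - ∑ i, ∑ j, c i * c j * ⟪v' i, z' j⟫_ℝ) < 0 := by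
  obtain ⟨U, hU, hneg⟩ := hk
  refine ⟨U, hU, fun c hc hc0 => ?_⟩
  have h1 := hneg c hc hc0
  have h2 := capacitanceForm_mono B B' J hsymm' hnonneg' hcomp hz hz' hpull c
  linarith

/-- **Sub-criticality passes DOWN**: a bound `cᵀM'c ≤ θ|c|²` for the big rung holds for the small
one. [cite: HornJohnson2013, Cor. 7.7.4] -/
theorem capacitanceForm_le_of_big (hsymm' : ∀ x y : E', ⟪B' x, y⟫_ℝ = ⟪x, B' y⟫_ℝ)
    (hnonneg' : ∀ y : E', 0 ≤ ⟪B' y, y⟫_ℝ)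
    (hcomp : ∀ x : E, ⟪B x, x⟫_ℝ = ⟪B' (J x), J x⟫_ℝ)
    {z v : ι → E} {z' v' : ι → E'} (hz : ∀ i, B (z i) = v i) (hz' : ∀ i, B' (z' i) = v' i)
    (hpull : ∀ i (x : E), ⟪v i, x⟫_ℝ = ⟪v' i, J x⟫_ℝ) {θ : ℝ}
    (hθ : ∀ c : ι → ℝ, ∑ i, ∑ j, c i * c j * ⟪v' i, z' j⟫_ℝ ≤ θ * ∑ i, c i ^ 2) (c : ι → ℝ) :
    ∑ i, ∑ j, c i * c j * ⟪v i, z j⟫_ℝ ≤ θ * ∑ i, c i ^ 2 :=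
  (capacitanceForm_mono B B' J hsymm' hnonneg' hcomp hz hz' hpull c).trans (hθ c)

end Nested

/-! ## 3. Nested splits: the form is the compression, the premise passes down, monotone `M` -/

section Splits

variable {ι : Type*} [Fintype ι] {T : E →ₗ[ℝ] E} {T' : E' →ₗ[ℝ] E'}
  (S : OffLineSplitN T ι) (S' : OffLineSplitN T' ι) (J : E →ₗ[ℝ] E')

/-- For NESTED splits (remainder compressed, drivers pulled back) the window form itself is the
compression of the big window form: `⟪T x, x⟫ = ⟪T'(Jx), Jx⟫`. [folklore] -/
theorem inner_apply_self_nested (hcomp : ∀ x : E, ⟪S.B x, x⟫_ℝ = ⟪S'.B (J x), J x⟫_ℝ)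
    (hpull : ∀ i (x : E), ⟪S.v i, x⟫_ℝ = ⟪S'.v i, J x⟫_ℝ) (x : E) :
    ⟪T x, x⟫_ℝ = ⟪T' (J x), J x⟫_ℝ := by
  rw [S.inner_apply_self, S'.inner_apply_self, hcomp]
  congr 1
  exact Finset.sum_congr rfl fun i _ => by rw [hpull]

/-- **The premise passes DOWN the ladder**: if the big remainder is coercive with constant `β` and
`J` is isometric, the small remainder is coercive with the same `β` — positive definiteness need only
be certified at the TOP rung. [cite: HornJohnson2013, Thm 4.3.28] -/
theorem coercive_of_nested {β : ℝ} (hJ : ∀ x : E, ⟪J x, J x⟫_ℝ = ⟪x, x⟫_ℝ)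
    (hcomp : ∀ x : E, ⟪S.B x, x⟫_ℝ = ⟪S'.B (J x), J x⟫_ℝ)
    (hco' : ∀ y : E', β * ⟪y, y⟫_ℝ ≤ ⟪S'.B y, y⟫_ℝ) (x : E) :
    β * ⟪x, x⟫_ℝ ≤ ⟪S.B x, x⟫_ℝ := by
  rw [← hJ x, hcomp x]; exact hco' (J x)

/-- **Monotone capacitance, hypothesis-free given the top-rung premise** (finite dimension): if the
big remainder is coercive and `J` isometric, BOTH witness families exist and the capacitance forms
satisfy `cᵀM c ≤ cᵀM' c` for every `c`; with `PfPersistenceIntruderWitness.secular_law` on each rung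
(`n₋ = #{μ > 1}`) every count `#{μₖ > t}` is non-decreasing. [cite: HornJohnson2013, Cor. 7.7.4] -/
theorem capacitance_mono_of_nested [FiniteDimensional ℝ E] [FiniteDimensional ℝ E'] {β : ℝ}
    (hβ : 0 < β) (hco' : ∀ y : E', β * ⟪y, y⟫_ℝ ≤ ⟪S'.B y, y⟫_ℝ)
    (hJ : ∀ x : E, ⟪J x, J x⟫_ℝ = ⟪x, x⟫_ℝ)
    (hcomp : ∀ x : E, ⟪S.B x, x⟫_ℝ = ⟪S'.B (J x), J x⟫_ℝ)
    (hpull : ∀ i (x : E), ⟪S.v i, x⟫_ℝ = ⟪S'.v i, J x⟫_ℝ) :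
    ∃ (z : ι → E) (z' : ι → E'), (∀ i, S.B (z i) = S.v i) ∧ (∀ i, S'.B (z' i) = S'.v i) ∧
      (∀ c : ι → ℝ, ∑ i, ∑ j, c i * c j * ⟪S.v i, z j⟫_ℝ ≤ ∑ i, ∑ j, c i * c j * ⟪S'.v i, z' j⟫_ℝ) ∧
      ∀ (t : ℝ) (k : ℕ), (∃ U : Submodule ℝ (ι → ℝ), Module.finrank ℝ U = k ∧
          ∀ c ∈ U, c ≠ 0 → (t * ∑ i, c i ^ 2 - ∑ i, ∑ j, c i * c j * ⟪S.v i, z j⟫_ℝ) < 0) →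
        ∃ U : Submodule ℝ (ι → ℝ), Module.finrank ℝ U = k ∧
          ∀ c ∈ U, c ≠ 0 → (t * ∑ i, c i ^ 2 - ∑ i, ∑ j, c i * c j * ⟪S'.v i, z' j⟫_ℝ) < 0 := by
  obtain ⟨z, hz⟩ := exists_witnesses S hβ (coercive_of_nested S S' J hJ hcomp hco')
  obtain ⟨z', hz'⟩ := exists_witnesses S' hβ hco'
  exact ⟨z, z', hz, hz',
    fun c => capacitanceForm_mono S.B S'.B J S'.B_symm S'.B_nonneg hcomp hz hz' hpull c,
    fun t _k hk => negSubspace_threshold_mono S.B S'.B J S'.B_symm S'.B_nonneg hcomp hz hz' hpull t hk⟩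

end Splits

/-! ## 4. Positive definite ⇒ coercive in finite dimension -/

/-- **`PD ⇒ coercive`**: on a finite-dimensional real inner product space a linear map with
`⟪Bx, x⟫ > 0` for all `x ≠ 0` is coercive: `∃ β > 0, ∀ x, β⟪x,x⟫ ≤ ⟪Bx,x⟫` (minimum of the
continuous form on the compact unit sphere).  So the premise of every gen-8 theorem is exactly
'the remainder is positive definite'. [folklore] -/
theorem exists_coercive_of_pos [FiniteDimensional ℝ E] (B : E →ₗ[ℝ] E)
    (hpos : ∀ x : E, x ≠ 0 → 0 < ⟪B x, x⟫_ℝ) :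
    ∃ β : ℝ, 0 < β ∧ ∀ x : E, β * ⟪x, x⟫_ℝ ≤ ⟪B x, x⟫_ℝ := by
  by_cases hE : ∃ x : E, x ≠ 0
  · obtain ⟨x₀, hx₀⟩ := hE
    have hcont : Continuous fun x : E => ⟪B x, x⟫_ℝ :=
      B.continuous_of_finiteDimensional.inner continuous_id
    have hne : (Metric.sphere (0 : E) 1).Nonempty := by
      refine ⟨‖x₀‖⁻¹ • x₀, ?_⟩
      rw [mem_sphere_zero_iff_norm, norm_smul, norm_inv, norm_norm,
        inv_mul_cancel₀ (norm_ne_zero_iff.mpr hx₀)]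
    obtain ⟨u, hu, hmin⟩ := (isCompact_sphere (0 : E) 1).exists_isMinOn hne hcont.continuousOn
    have hu1 : ‖u‖ = 1 := mem_sphere_zero_iff_norm.mp hu
    have hu0 : u ≠ 0 := by
      intro h; rw [h, norm_zero] at hu1; exact zero_ne_one hu1
    refine ⟨⟪B u, u⟫_ℝ, hpos u hu0, fun x => ?_⟩
    by_cases hx : x = 0
    · rw [hx, inner_self_eq_zero.mpr rfl, map_zero, inner_zero_left, mul_zero]
    · have hxn : 0 < ‖x‖ := norm_pos_iff.mpr hx
      have hmem : ‖x‖⁻¹ • x ∈ Metric.sphere (0 : E) 1 := by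
        rw [mem_sphere_zero_iff_norm, norm_smul, norm_inv, norm_norm, inv_mul_cancel₀ hxn.ne']
      have h1 := hmin hmem
      simp only [Set.mem_setOf_eq, map_smul, real_inner_smul_left, real_inner_smul_right] at h1
      rw [real_inner_self_eq_norm_sq]
      have h2 : ⟪B u, u⟫_ℝ ≤ ⟪B x, x⟫_ℝ / ‖x‖ ^ 2 := by
        calc ⟪B u, u⟫_ℝ ≤ ‖x‖⁻¹ * (‖x‖⁻¹ * ⟪B x, x⟫_ℝ) := h1
          _ = ⟪B x, x⟫_ℝ / ‖x‖ ^ 2 := by field_simp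
      rwa [le_div_iff₀ (by positivity)] at h2
  · push Not at hE
    exact ⟨1, one_pos, fun x => by simp [hE x]⟩

/-- **Corollary**: a positive definite remainder in finite dimension yields a coercivity constant, so
all of `PfPersistenceIntruderWitness` §§2–4 apply (witnesses exist uniquely, secular / arrival laws
hypothesis-free) under the bare premise `∀ x ≠ 0, 0 < ⟪Bx,x⟫`. [folklore] -/
theorem exists_witnesses_of_pos [FiniteDimensional ℝ E] {ι : Type*} [Fintype ι] {T : E →ₗ[ℝ] E}
    (S : OffLineSplitN T ι) (hpos : ∀ x : E, x ≠ 0 → 0 < ⟪S.B x, x⟫_ℝ) :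
    ∃ β : ℝ, 0 < β ∧ (∀ x : E, β * ⟪x, x⟫_ℝ ≤ ⟪S.B x, x⟫_ℝ) ∧
      ∃ z : ι → E, ∀ i, S.B (z i) = S.v i := by
  obtain ⟨β, hβ, hco⟩ := exists_coercive_of_pos S.B hpos
  exact ⟨β, hβ, hco, exists_witnesses S hβ hco⟩

/-! ## 5. The ladder limit: a non-decreasing real sequence converges to its supremum or diverges -/

/-- **Ladder dichotomy**: a real sequence with `s N ≤ s (N+1)` (the rungs of the capacitance, by
`secular_mono` applied to each consecutive nested pair) EITHER is bounded above, converges to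
`⨆ N, s N`, and is bounded by it at every rung, OR is unbounded above and tends to `+∞`.  Which
alternative holds for a given family and `a` is DATA (THEORY-INTRUDER §14). [folklore] -/
theorem ladder_dichotomy (s : ℕ → ℝ) (hs : ∀ N, s N ≤ s (N + 1)) :
    (BddAbove (Set.range s) ∧ Tendsto s atTop (𝓝 (⨆ N, s N)) ∧ ∀ N, s N ≤ ⨆ N, s N) ∨
      (¬ BddAbove (Set.range s) ∧ Tendsto s atTop atTop) := by
  have hmono : Monotone s := monotone_nat_of_le_succ hs
  by_cases hb : BddAbove (Set.range s)
  · exact Or.inl ⟨hb, tendsto_atTop_ciSup hmono hb, fun N => le_ciSup hb N⟩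
  · refine Or.inr ⟨hb, hmono.tendsto_atTop_atTop fun b => ?_⟩
    obtain ⟨_, ⟨a, rfl⟩, hlt⟩ := not_bddAbove_iff.mp hb b
    exact ⟨a, hlt.le⟩

/-- **Up-crossings are permanent**: once a rung exceeds a threshold (`t < s N₀`, e.g. `t = 1`:
the window has gone indefinite by the secular law), every later rung does. [folklore] -/
theorem threshold_upcrossing_permanent (s : ℕ → ℝ) (hs : ∀ N, s N ≤ s (N + 1)) {t : ℝ} {N₀ : ℕ}
    (h : t < s N₀) {N : ℕ} (hN : N₀ ≤ N) : t < s N :=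
  lt_of_lt_of_le h (monotone_nat_of_le_succ hs hN)

end Summit.RiemannHypothesis.RiemannHypothesis.Theorems.PfPersistenceIntruderCapacitanceMono
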